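import Summits.QuantumFields.YangMills.Theorems.CoarseStiffnessTailCappedCoarseStiffnessLCombTreeGauge

/-!
# Route `CoarseStiffnessTail` — THE ABELIAN-FLAT GAUSSIAN LOWER BOUND `log Z_P(β) ≥ −((N²−1)/2)(d−1)|T|·log β − C|T|` on Bałaban's tori
# (lead's certificate, seat `ym-line-cst-p1` g15; helper on 25301 `CappedCoarseStiffnessL`, stub S3 = uniform mean action)

THE THEOREM (`log_partitionFn_ge_abelianFlat_specialUnitary`, `G = SU(N)`, every `Params` `P`, `β ≥ 1`):

  `log Z_P(β) ≥ −(d − 1)·|T₁^{(0)}|·(((N²−1)/2)·log β + C_N) − 8d²·|T₁^{(0)}|`,   `C_N = N²·log(16π+1) + log((2N+1)/(4π))`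

— the Gaussian power `((N²−1)/2)(d−1)|T|` EXACTLY (the tree's `N13GaugeFixingAxialLayers` has `((d−1) + 1/n)|T|`).

PROOF.  (1) Gauge the FULL comb tree `𝒯` (`|T| − 1` bonds; companion `…LCombTreeGauge`): `haar(B)^{|𝒯|}·Z = ∫ e^{−βA}·Π_𝒯 1_B(U_b) dU`,
`B` the `SU(N)` operator ball of radius `τ = β^{−1/2}`.  (2) THE ABELIAN-FLAT BOX.  For `a ∈ G` let `S(a) = {U : U_b ∈ B for non-wrapping b,
a⁻¹U_b ∈ B for wrapping b}` (`b = ⟨x, e_k⟩` wraps iff `x_k = −1`): a `τ`-neighbourhood of the FLAT connection with all holonomies equal to `a`.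
Opposite links of a plaquette wrap together, so `U(∂p) = (s y₁)(t y₂)(s y₃)⁻¹(t y₄)⁻¹` with `s, t ∈ {1, a}` COMMUTING and `|y_i − 1| ≤ τ`,
whence `|U(∂p) − 1| ≤ 4τ` by the insertion inequality `|u g v − 1| ≤ |u v − 1| + |g − 1|` (`dist1_word_le`), and `A ≤ 8τ²·#plaq` on `S(a)`
(`wilsonAction4_le_of_abelianBox`).  (3) AVERAGING OVER `a`: `Φ(a, U) = Π_b 1_B(σ_b(a)⁻¹U_b)` has `∫Φ(a,U) da ≤ haar(B)` (the corner bond alone)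
and `∫Φ(a,U) dU = haar(B)^{#bonds}` for every `a`; tree bonds do not wrap, so `Φ·Π_𝒯 1_B = Φ`.  Tonelli:
`e^{−8βτ²#plaq}·haar(B)^{#bonds} = e^{−8βτ²#plaq}∫∫Φ ≤ ∫ e^{−βA}Π_𝒯 1_B·(∫Φ da) dU ≤ haar(B)·haar(B)^{|𝒯|}·Z`, i.e.
`Z ≥ e^{−8βτ²#plaq}·haar(B)^{#bonds − |T|} = e^{−8d²|T|}·haar(B)^{(d−1)|T|}`, and `log haar(B_τ) ≥ (N²−1) log τ − C_N`
(`log_haarReal_suOpBall_ge`).  The single free holonomy `a` is what removes the last `(N²−1)/2·log β`: the box around `U ≡ 1` alone gives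
`(d−1)|T| + 1` Gaussian factors.

WHY (line card `Cruxes/CappedCoarseStiffnessL/Lines/birth.md` §g15).  With the companion UPPER bound `log Z_P(β') ≤ (d−1)(|T|−1)·log linkMass(β')`
(`…LCornerCombBound`) the partition sandwich on Bałaban's tori is pinned to `O(|T| + log β)` instead of N13's `O(|T| + (|T|/n) log β)`:
the bare faces of the crux and the uniform mean action (stub S3) follow for `log β_K ≲ |T|`, i.e. everywhere outside the hyper-weak corner
`log γ⁻¹ ≳ L^{3(m+K)}` (companion `…LVolumeUniformStiffness`).

HONEST SCOPE.  Elementary (gauge fixing, a box, Tonelli, the tree's small-ball mass); nothing of Bałaban's is asserted; the crux 25301, its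
stubs S1/S2/S3, `HistoryTailL` 19936 stay OPEN; `YM3TorusSU2` (R3, RECORD rung, not Clay) is NOT proved; the Yang–Mills mass gap is NOT touched.

References: T. Bałaban, CMP **109** (1987) 249–301 [Balaban1987RG1] ((0.14)–(0.16) pp.254–255); I. Montvay, G. Münster, *Quantum Fields on
a Lattice* (1994) §3.2.5 [MontvayMunster1994].
-/

noncomputable section

open MeasureTheory
open scoped BigOperators

namespace Summit.QuantumFields.YangMills.Theorems.CoarseStiffnessTailAbelianFlatLowerBound

open Literature.MathematicalPhysics.QuantumFieldTheory.Balaban1983to89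
open Missing B16ZLower T4StabilityFloorUnitary
open Summit.QuantumFields.YangMills.BalabanUVNodes.N13GaugeFixingTargetDisjointBondFamily
  (integral_indicator_mul_left_eq_haarReal gaugeInvariant_boltzmann)
open Summit.QuantumFields.YangMills.BalabanUVNodes.N13WilsonPartitionFnGaugeFixedLowerBound (card_plaq_le log_haarReal_suOpBall_ge)
open Summit.QuantumFields.YangMills.BalabanUVNodes.N13GaugeFixingAxialLayers (shift_apply_ne)
open Summit.QuantumFields.YangMills.Theorems.CoarseStiffnessTailCombTreeGauge (pow_mul_integral_eq_prod_indicator_combTree card_combTree)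

/-! ## §1 The insertion inequality and the commuting word -/

section Word

variable {G : Type*} [GaugeGroup G]

/-- INSERTION: `|u·g·v − 1| ≤ |u·v − 1| + |g − 1|` (`u g v = (u v)(v⁻¹ g v)`, subadditivity and conjugation invariance of `dist1`). [folklore] -/
theorem dist1_insert_le (u g v : G) : dist1 (u * g * v) ≤ dist1 (u * v) + dist1 g := by
  have h1 : u * g * v = (u * v) * (v⁻¹ * g * v⁻¹⁻¹) := by group
  rw [h1]
  calc dist1 ((u * v) * (v⁻¹ * g * v⁻¹⁻¹)) ≤ dist1 (u * v) + dist1 (v⁻¹ * g * v⁻¹⁻¹) := GaugeGroup.dist1_mul_le _ _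
    _ = dist1 (u * v) + dist1 g := by rw [GaugeGroup.dist1_conj]

/-- **THE COMMUTING WORD**: for commuting `s, t` and any `y₁,…,y₄`,
`|(s y₁)(t y₂)(s y₃)⁻¹(t y₄)⁻¹ − 1| ≤ |y₁ − 1| + |y₂ − 1| + |y₃ − 1| + |y₄ − 1|` — strip the four insertions, `s t s⁻¹ t⁻¹ = 1`. [folklore] -/
theorem dist1_word_le (s t y₁ y₂ y₃ y₄ : G) (hst : s * t = t * s) :
    dist1 ((s * y₁) * (t * y₂) * (s * y₃)⁻¹ * (t * y₄)⁻¹) ≤ dist1 y₁ + dist1 y₂ + dist1 y₃ + dist1 y₄ := by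
  have hcomm : s * t * s⁻¹ * t⁻¹ = 1 := by rw [hst]; group
  calc dist1 ((s * y₁) * (t * y₂) * (s * y₃)⁻¹ * (t * y₄)⁻¹)
      = dist1 (s * y₁ * (t * y₂ * y₃⁻¹ * s⁻¹ * y₄⁻¹ * t⁻¹)) := by congr 1; group
    _ ≤ dist1 (s * (t * y₂ * y₃⁻¹ * s⁻¹ * y₄⁻¹ * t⁻¹)) + dist1 y₁ := dist1_insert_le _ _ _
    _ = dist1 ((s * t) * y₂ * (y₃⁻¹ * s⁻¹ * y₄⁻¹ * t⁻¹)) + dist1 y₁ := by congr 2; group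
    _ ≤ dist1 ((s * t) * (y₃⁻¹ * s⁻¹ * y₄⁻¹ * t⁻¹)) + dist1 y₂ + dist1 y₁ := by linarith [dist1_insert_le (s * t) y₂ (y₃⁻¹ * s⁻¹ * y₄⁻¹ * t⁻¹)]
    _ = dist1 ((s * t) * y₃⁻¹ * (s⁻¹ * y₄⁻¹ * t⁻¹)) + dist1 y₂ + dist1 y₁ := by congr 3; group
    _ ≤ dist1 ((s * t) * (s⁻¹ * y₄⁻¹ * t⁻¹)) + dist1 y₃⁻¹ + dist1 y₂ + dist1 y₁ := by linarith [dist1_insert_le (s * t) y₃⁻¹ (s⁻¹ * y₄⁻¹ * t⁻¹)]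
    _ = dist1 ((s * t * s⁻¹) * y₄⁻¹ * t⁻¹) + dist1 y₃⁻¹ + dist1 y₂ + dist1 y₁ := by congr 4; group
    _ ≤ dist1 ((s * t * s⁻¹) * t⁻¹) + dist1 y₄⁻¹ + dist1 y₃⁻¹ + dist1 y₂ + dist1 y₁ := by linarith [dist1_insert_le (s * t * s⁻¹) y₄⁻¹ t⁻¹]
    _ = dist1 y₁ + dist1 y₂ + dist1 y₃ + dist1 y₄ := by
        rw [hcomm, GaugeGroup.dist1_one, GaugeGroup.dist1_inv, GaugeGroup.dist1_inv]; ring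

end Word

/-! ## §2 The abelian-flat box: the action is `≤ 8τ²·#plaq` -/

section Box

variable (N : ℕ) [NeZero N] {P : Params}

/-- **THE ACTION ON THE ABELIAN-FLAT BOX** (`G = SU(N)`): if `σ_b(a)⁻¹·U_b ∈ B_τ` for every bond, where `σ_b(a) = a` for wrapping bonds
(`x_k = −1`) and `1` otherwise, then `A(U) ≤ 8τ²·#plaquettes`.  Opposite links of a plaquette wrap together; `dist1_word_le`;
`1 − Re tr ≤ ½|· − 1|²`. [folklore] -/
theorem wilsonAction4_le_of_abelianBox {τ : ℝ} (a : Matrix.specialUnitaryGroup (Fin N) ℂ)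
    {U : GaugeField P 0 (Matrix.specialUnitaryGroup (Fin N) ℂ)}
    (hU : ∀ b : PBond P 0, (if b.src b.dir = -1 then a else 1)⁻¹ * U b ∈ suOpBall N τ) :
    wilsonAction4 U ≤ 8 * τ ^ 2 * Fintype.card (Plaq P 0) := by
  rw [wilsonAction4_eq_sum]
  have hy : ∀ b : PBond P 0, dist1 ((if b.src b.dir = -1 then a else 1)⁻¹ * U b) ≤ τ := fun b => mem_suOpBall_iff_dist1.1 (hU b)
  have hp : ∀ p : Plaq P 0, 1 - reTr (GaugeField.plaqHol U p) ≤ 8 * τ ^ 2 := by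
    intro p
    set s : Matrix.specialUnitaryGroup (Fin N) ℂ := if p.src p.μ = -1 then a else 1 with hs
    set t : Matrix.specialUnitaryGroup (Fin N) ℂ := if p.src p.ν = -1 then a else 1 with ht
    have hst : s * t = t * s := by
      rw [hs, ht]; split_ifs <;> simp
    have hμν : p.μ ≠ p.ν := Fin.ne_of_lt p.hμν
    -- the four links as `σ·y`
    set y₁ := s⁻¹ * U ⟨p.src, p.μ⟩ with hy₁
    set y₂ := t⁻¹ * U ⟨p.src.shift p.μ, p.ν⟩ with hy₂
    set y₃ := s⁻¹ * U ⟨p.src.shift p.ν, p.μ⟩ with hy₃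
    set y₄ := t⁻¹ * U ⟨p.src, p.ν⟩ with hy₄
    have h3src : (p.src.shift p.ν) p.μ = p.src p.μ := shift_apply_ne P 0 _ _ _ hμν
    have h2src : (p.src.shift p.μ) p.ν = p.src p.ν := shift_apply_ne P 0 _ _ _ hμν.symm
    have hd₁ : dist1 y₁ ≤ τ := by have := hy ⟨p.src, p.μ⟩; rwa [← hs] at this
    have hd₂ : dist1 y₂ ≤ τ := by have := hy ⟨p.src.shift p.μ, p.ν⟩; simp only [h2src] at this; rwa [← ht] at this
    have hd₃ : dist1 y₃ ≤ τ := by have := hy ⟨p.src.shift p.ν, p.μ⟩; simp only [h3src] at this; rwa [← hs] at this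
    have hd₄ : dist1 y₄ ≤ τ := by have := hy ⟨p.src, p.ν⟩; rwa [← ht] at this
    have hhol : GaugeField.plaqHol U p = (s * y₁) * (t * y₂) * (s * y₃)⁻¹ * (t * y₄)⁻¹ := by
      unfold GaugeField.plaqHol
      rw [hy₁, hy₂, hy₃, hy₄]
      simp only [mul_inv_cancel_left]
    have hdist : dist1 (GaugeField.plaqHol U p) ≤ 4 * τ := by
      rw [hhol]
      linarith [dist1_word_le s t y₁ y₂ y₃ y₄ hst]
    have h1 := one_sub_reTr_le_half_dist1_sq_specialUnitary (N := N) (GaugeField.plaqHol U p)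
    have h3 : dist1 (GaugeField.plaqHol U p) ^ 2 ≤ (4 * τ) ^ 2 := pow_le_pow_left₀ (GaugeGroup.dist1_nonneg _) hdist 2
    nlinarith
  calc ∑ p, (1 - reTr (GaugeField.plaqHol U p)) ≤ ∑ _p : Plaq P 0, 8 * τ ^ 2 := Finset.sum_le_sum fun p _ => hp p
    _ = 8 * τ ^ 2 * Fintype.card (Plaq P 0) := by rw [Finset.sum_const, Finset.card_univ, nsmul_eq_mul, mul_comm]

end Box

/-! ## §3 Averaging over the free holonomy and the lower bound -/

section LowerBound

variable (N : ℕ) [NeZero N]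

/-- `∫ 1_B(a⁻¹·w) da = haar(B)` (inversion then right invariance of the Haar datum). [folklore] -/
theorem integral_indicator_inv_mul_eq_haarReal {G : Type*} [GaugeGroup G] [MeasurableSpace G] [HaarData G] [MeasurableMul₂ G]
    [MeasurableInv G] {B : Set G} (hB : MeasurableSet B) (w : G) :
    ∫ a, B.indicator (fun _ => (1 : ℝ)) (a⁻¹ * w) ∂(HaarData.haar : Measure G) = (HaarData.haar : Measure G).real B := by
  have hinv : (∫ a, B.indicator (fun _ => (1 : ℝ)) (a⁻¹ * w) ∂(HaarData.haar : Measure G)) =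
      ∫ a, B.indicator (fun _ => (1 : ℝ)) (a * w) ∂((HaarData.haar : Measure G).map (fun h => h⁻¹)) := by
    rw [integral_map measurable_inv.aemeasurable]
    exact ((measurable_const.indicator hB).comp (measurable_mul_const w)).aestronglyMeasurable
  rw [hinv, HaarData.map_inv]
  have hright : (∫ a, B.indicator (fun _ => (1 : ℝ)) (a * w) ∂(HaarData.haar : Measure G)) =
      ∫ a, B.indicator (fun _ => (1 : ℝ)) a ∂((HaarData.haar : Measure G).map (fun h => h * w)) := by
    rw [integral_map (measurable_mul_const w).aemeasurable]
    exact (measurable_const.indicator hB).aestronglyMeasurable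
  rw [hright, HaarData.map_mul_right]
  exact integral_indicator_one hB

/-- **★★★ THE ABELIAN-FLAT GAUSSIAN LOWER BOUND ON BAŁABAN's TORUS PARTITION FUNCTION, `G = SU(N)`.**  For every `Params` `P` and `β ≥ 1`:
`log Z_P(β) ≥ −(d−1)·|T₁^{(0)}|·(((N²−1)/2)·log β + C_N) − 8d²·|T₁^{(0)}|`, `C_N = N²·log(16π+1) + log((2N+1)/(4π))` — the full comb tree
gauged away and the box around the abelian flat connections `U ≡ a` on wrapping bonds, averaged over `a`. [folklore] -/
theorem log_partitionFn_ge_abelianFlat_specialUnitary (P : Params) {β : ℝ} (hβ : 1 ≤ β) :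
    -(((P.d : ℝ) - 1) * (Fintype.card (Site P 0) : ℝ)) *
        ((((N * N : ℕ) : ℝ) - 1) / 2 * Real.log β + (((N * N : ℕ) : ℝ) * Real.log (16 * Real.pi + 1) + Real.log ((2 * N + 1) / (4 * Real.pi))))
        - 8 * (P.d : ℝ) ^ 2 * (Fintype.card (Site P 0) : ℝ) ≤
      Real.log (partitionFn (G := Matrix.specialUnitaryGroup (Fin N) ℂ) P β) := by
  classical
  set G := Matrix.specialUnitaryGroup (Fin N) ℂ
  have hβ0 : 0 < β := lt_of_lt_of_le one_pos hβ
  set τ : ℝ := (Real.sqrt β)⁻¹ with hτdef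
  have hsq : 0 < Real.sqrt β := Real.sqrt_pos.2 hβ0
  have hτ : 0 < τ := inv_pos.2 hsq
  have hτ1 : τ ≤ 1 := by rw [hτdef]; exact inv_le_one_of_one_le₀ (Real.one_le_sqrt.2 hβ)
  have hτsq : τ ^ 2 = β⁻¹ := by rw [hτdef, inv_pow, Real.sq_sqrt hβ0.le]
  have hlogτ : Real.log τ = -(1 / 2) * Real.log β := by rw [hτdef, Real.log_inv, Real.log_sqrt hβ0.le]; ring
  set B : Set G := suOpBall N τ with hBdef
  have hB : MeasurableSet B := measurableSet_suOpBall τ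
  set c : ℝ := (HaarData.haar : Measure G).real B with hc
  have hcpos : 0 < c := haarReal_suOpBall_pos (N := N) hτ
  haveI : IsProbabilityMeasure (HaarData.haar : Measure G) := HaarData.isProb
  haveI := isProbabilityMeasure_fieldMeasure (G := G) P 0
  -- (1) the comb-tree identity at the Boltzmann weight
  set Tr : Finset (PBond P 0) := Finset.univ.filter fun b : PBond P 0 =>
    (∀ i, i < b.dir → b.src i = 0) ∧ (b.src b.dir).val < P.sitesPerDir 0 - 1 with hTr
  have hid := pow_mul_integral_eq_prod_indicator_combTree P 0 hB (gaugeInvariant_boltzmann P β)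
    (integrable_boltzmann RegularGaugeGroup.measurable_reTr P hβ0.le)
  rw [← hTr] at hid
  -- (2) the averaged box function `Φ(a, U) = Π_b 1_B(σ_b(a)⁻¹ U_b)`
  set σ : PBond P 0 → G → G := fun b a => if b.src b.dir = -1 then a else 1 with hσ
  set Φ : G → GaugeField P 0 G → ℝ := fun a U => ∏ b, B.indicator (fun _ => (1 : ℝ)) ((σ b a)⁻¹ * U b) with hΦ
  have hσmeas : ∀ b : PBond P 0, Measurable (σ b) := by
    intro b; simp only [hσ]; split_ifs
    · exact measurable_id
    · exact measurable_const
  have hΦnn : ∀ a U, 0 ≤ Φ a U := fun a U => Finset.prod_nonneg fun b _ => Set.indicator_nonneg (fun _ _ => zero_le_one) _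
  have hΦle : ∀ a U, Φ a U ≤ 1 := fun a U =>
    Finset.prod_le_one (fun b _ => Set.indicator_nonneg (fun _ _ => zero_le_one) _)
      fun b _ => Set.indicator_le_self' (fun _ _ => zero_le_one) _
  have hΦmeas : Measurable (Function.uncurry Φ) := by
    refine Finset.measurable_prod _ fun b _ => ?_
    refine (measurable_const.indicator hB).comp ?_
    exact ((hσmeas b).comp measurable_fst).inv.mul ((measurable_pi_apply b).comp measurable_snd)
  -- (2a) `∫ Φ(a, U) dU = c ^ #bonds` for every `a`
  have hΦU : ∀ a : G, ∫ U, Φ a U ∂(fieldMeasure P 0 G) = c ^ Fintype.card (PBond P 0) := by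
    intro a
    show (∫ U : PBond P 0 → G, ∏ b, B.indicator (fun _ => (1 : ℝ)) ((σ b a)⁻¹ * U b)
      ∂(Measure.pi fun _ : PBond P 0 => (HaarData.haar : Measure G))) = _
    rw [integral_fintype_prod_eq_prod (fun (b : PBond P 0) (w : G) => B.indicator (fun _ => (1 : ℝ)) ((σ b a)⁻¹ * w))]
    simp_rw [integral_indicator_mul_left_eq_haarReal hB]
    rw [Finset.prod_const, Finset.card_univ]
  -- (2b) `∫ Φ(a, U) da ≤ c` for every `U` (the corner bond `⟨c*, e₀⟩` wraps)
  set bstar : PBond P 0 := ⟨fun _ => -1, ⟨0, P.hd⟩⟩ with hbstar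
  have hσstar : ∀ a, σ bstar a = a := fun a => by simp [hσ, hbstar]
  have hΦa : ∀ U : GaugeField P 0 G, ∫ a, Φ a U ∂(HaarData.haar : Measure G) ≤ c := by
    intro U
    have hle : ∀ a, Φ a U ≤ B.indicator (fun _ => (1 : ℝ)) (a⁻¹ * U bstar) := by
      intro a
      -- a single factor bounds the product of factors in `[0,1]`
      calc Φ a U = B.indicator (fun _ => (1 : ℝ)) ((σ bstar a)⁻¹ * U bstar) *
            ∏ b ∈ Finset.univ.erase bstar, B.indicator (fun _ => (1 : ℝ)) ((σ b a)⁻¹ * U b) := by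
            rw [hΦ]; exact (Finset.mul_prod_erase _ _ (Finset.mem_univ bstar)).symm
        _ ≤ B.indicator (fun _ => (1 : ℝ)) ((σ bstar a)⁻¹ * U bstar) * 1 := by
            refine mul_le_mul_of_nonneg_left ?_ (Set.indicator_nonneg (fun _ _ => zero_le_one) _)
            exact Finset.prod_le_one (fun b _ => Set.indicator_nonneg (fun _ _ => zero_le_one) _)
              fun b _ => Set.indicator_le_self' (fun _ _ => zero_le_one) _
        _ = B.indicator (fun _ => (1 : ℝ)) (a⁻¹ * U bstar) := by rw [mul_one, hσstar]
    calc ∫ a, Φ a U ∂(HaarData.haar : Measure G) ≤ ∫ a, B.indicator (fun _ => (1 : ℝ)) (a⁻¹ * U bstar) ∂(HaarData.haar : Measure G) := by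
          refine integral_mono_of_nonneg (Filter.Eventually.of_forall fun a => hΦnn a U) ?_ (Filter.Eventually.of_forall hle)
          refine Integrable.of_bound ((measurable_const.indicator hB).comp (measurable_inv.mul_const _)).aestronglyMeasurable 1
            (Filter.Eventually.of_forall fun a => ?_)
          show ‖B.indicator (fun _ => (1 : ℝ)) (a⁻¹ * U bstar)‖ ≤ 1
          rw [Real.norm_eq_abs, abs_of_nonneg (Set.indicator_nonneg (fun _ _ => zero_le_one) _)]
          exact Set.indicator_le_self' (fun _ _ => zero_le_one) _
      _ = c := integral_indicator_inv_mul_eq_haarReal hB (U bstar)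
  -- (2c) on the support of `Φ(a, ·)`: the action bound, and the tree indicators are `1`
  have hΦbox : ∀ a U, Φ a U ≠ 0 → ∀ b, (σ b a)⁻¹ * U b ∈ B := by
    intro a U hne b
    by_contra hb
    exact hne (Finset.prod_eq_zero (Finset.mem_univ b) (Set.indicator_of_notMem hb _))
  set κ : ℝ := Real.exp (-(β * (8 * τ ^ 2 * Fintype.card (Plaq P 0)))) with hκ
  have hpt : ∀ a U, κ * Φ a U ≤ (boltzmann P β U * ∏ b ∈ Tr, B.indicator (fun _ => (1 : ℝ)) (U b)) * Φ a U := by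
    intro a U
    by_cases hz : Φ a U = 0
    · rw [hz, mul_zero, mul_zero]
    · have hall := hΦbox a U hz
      have htree : ∏ b ∈ Tr, B.indicator (fun _ => (1 : ℝ)) (U b) = 1 := by
        refine Finset.prod_eq_one fun b hb => ?_
        have hval : (b.src b.dir).val < P.sitesPerDir 0 - 1 := (Finset.mem_filter.1 hb).2.2
        have hne : b.src b.dir ≠ -1 := by
          intro h
          have h1n : 1 < P.sitesPerDir 0 := by
            unfold Params.sitesPerDir
            have := Nat.one_le_pow (P.m + P.K - 0) P.L P.L_pos
            omega
          haveI : Fact (1 < P.sitesPerDir 0) := ⟨h1n⟩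
          have h0 : (b.src b.dir + 1).val = 0 := by rw [h, neg_add_cancel, ZMod.val_zero]
          rw [ZMod.val_add, ZMod.val_one] at h0
          have hdvd : P.sitesPerDir 0 ∣ (b.src b.dir).val + 1 := Nat.dvd_of_mod_eq_zero h0
          have hle := Nat.le_of_dvd (Nat.succ_pos _) hdvd
          omega
        have := hall b
        simp only [hσ, if_neg hne, inv_one, one_mul] at this
        simp [Set.indicator_of_mem this]
      rw [htree, mul_one]
      refine mul_le_mul_of_nonneg_right ?_ (hΦnn a U)
      rw [hκ, boltzmann]
      refine Real.exp_le_exp.2 ?_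
      have hA := wilsonAction4_le_of_abelianBox N a (U := U) (τ := τ) (by simpa [hσ] using hall)
      nlinarith
  -- (3) Tonelli
  have hint_prod : Integrable (Function.uncurry Φ) ((HaarData.haar : Measure G).prod (fieldMeasure P 0 G)) := by
    refine Integrable.of_bound hΦmeas.aestronglyMeasurable 1 (Filter.Eventually.of_forall fun q => ?_)
    show ‖Φ q.1 q.2‖ ≤ 1
    rw [Real.norm_eq_abs, abs_of_nonneg (hΦnn q.1 q.2)]
    exact hΦle q.1 q.2
  have hswap := integral_integral_swap hint_prod
  -- LHS: `∫_a ∫_U Φ = c^#bonds`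
  have hL : ∫ a, ∫ U, Φ a U ∂(fieldMeasure P 0 G) ∂(HaarData.haar : Measure G) = c ^ Fintype.card (PBond P 0) := by
    simp_rw [hΦU]
    rw [integral_const, smul_eq_mul, probReal_univ, one_mul]
  -- RHS bound: `∫_U (boltz·Π_Tr)(U) ∫_a Φ ≤ c · ∫_U boltz·Π_Tr`
  have hW_meas : Measurable fun U : GaugeField P 0 G => ∏ b ∈ Tr, B.indicator (fun _ => (1 : ℝ)) (U b) :=
    Finset.measurable_prod _ fun b _ => (measurable_const.indicator hB).comp (measurable_pi_apply b)
  have hW_bdd : ∀ U : GaugeField P 0 G, ‖∏ b ∈ Tr, B.indicator (fun _ => (1 : ℝ)) (U b)‖ ≤ 1 := by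
    intro U
    rw [Real.norm_eq_abs, Finset.abs_prod]
    refine Finset.prod_le_one (fun b _ => abs_nonneg _) fun b _ => ?_
    rw [abs_of_nonneg (Set.indicator_nonneg (fun _ _ => zero_le_one) _)]
    exact Set.indicator_le_self' (fun _ _ => zero_le_one) _
  have hWint : Integrable (fun U : GaugeField P 0 G => boltzmann P β U * ∏ b ∈ Tr, B.indicator (fun _ => (1 : ℝ)) (U b))
      (fieldMeasure P 0 G) :=
    (integrable_boltzmann RegularGaugeGroup.measurable_reTr P hβ0.le (G := G)).mul_of_top_left
      (memLp_top_of_bound hW_meas.aestronglyMeasurable 1 (Filter.Eventually.of_forall hW_bdd))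
  have hWnn : ∀ U : GaugeField P 0 G, 0 ≤ boltzmann P β U * ∏ b ∈ Tr, B.indicator (fun _ => (1 : ℝ)) (U b) := fun U =>
    mul_nonneg (boltzmann_pos P β U).le (Finset.prod_nonneg fun b _ => Set.indicator_nonneg (fun _ _ => zero_le_one) _)
  have hmain : κ * c ^ Fintype.card (PBond P 0) ≤ c * (c ^ Tr.card * partitionFn (G := G) P β) := by
    have hia : ∀ U : GaugeField P 0 G, Integrable (fun a => Φ a U) (HaarData.haar : Measure G) := fun U =>
      Integrable.of_bound ((hΦmeas.comp (measurable_id.prodMk measurable_const)).aestronglyMeasurable) 1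
        (Filter.Eventually.of_forall fun a => by
          show ‖Φ a U‖ ≤ 1
          rw [Real.norm_eq_abs, abs_of_nonneg (hΦnn a U)]; exact hΦle a U)
    have hptU : ∀ U : GaugeField P 0 G, κ * ∫ a, Φ a U ∂(HaarData.haar : Measure G) ≤
        (boltzmann P β U * ∏ b ∈ Tr, B.indicator (fun _ => (1 : ℝ)) (U b)) * c := by
      intro U
      calc κ * ∫ a, Φ a U ∂(HaarData.haar : Measure G) = ∫ a, κ * Φ a U ∂(HaarData.haar : Measure G) :=
            (integral_const_mul κ _).symm
        _ ≤ ∫ a, (boltzmann P β U * ∏ b ∈ Tr, B.indicator (fun _ => (1 : ℝ)) (U b)) * Φ a U ∂(HaarData.haar : Measure G) :=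
            integral_mono ((hia U).const_mul κ) ((hia U).const_mul _) fun a => hpt a U
        _ = (boltzmann P β U * ∏ b ∈ Tr, B.indicator (fun _ => (1 : ℝ)) (U b)) * ∫ a, Φ a U ∂(HaarData.haar : Measure G) :=
            integral_const_mul _ _
        _ ≤ (boltzmann P β U * ∏ b ∈ Tr, B.indicator (fun _ => (1 : ℝ)) (U b)) * c :=
            mul_le_mul_of_nonneg_left (hΦa U) (hWnn U)
    have hint_a : Integrable (fun U : GaugeField P 0 G => ∫ a, Φ a U ∂(HaarData.haar : Measure G)) (fieldMeasure P 0 G) :=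
      hint_prod.integral_prod_right
    calc κ * c ^ Fintype.card (PBond P 0)
        = κ * ∫ U, ∫ a, Φ a U ∂(HaarData.haar : Measure G) ∂(fieldMeasure P 0 G) := by rw [← hL, hswap]
      _ = ∫ U, κ * ∫ a, Φ a U ∂(HaarData.haar : Measure G) ∂(fieldMeasure P 0 G) := (integral_const_mul κ _).symm
      _ ≤ ∫ U, (boltzmann P β U * ∏ b ∈ Tr, B.indicator (fun _ => (1 : ℝ)) (U b)) * c ∂(fieldMeasure P 0 G) :=
          integral_mono_of_nonneg (Filter.Eventually.of_forall fun U =>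
              mul_nonneg (Real.exp_nonneg _) (integral_nonneg fun a => hΦnn a U)) (hWint.mul_const c)
            (Filter.Eventually.of_forall hptU)
      _ = c * (c ^ Tr.card * partitionFn (G := G) P β) := by
          rw [integral_mul_const, ← hid, show partitionFn (G := G) P β = ∫ U, boltzmann P β U ∂(fieldMeasure P 0 G) from rfl]
          ring
  -- (4) counts and logarithms
  have hZ : 0 < partitionFn (G := G) P β := partitionFn_pos' P hβ0.le
  set T : ℕ := Fintype.card (Site P 0) with hT
  have hT1 : 1 ≤ T := Fintype.card_pos
  have hbonds : Fintype.card (PBond P 0) = T * P.d := T4PlaqDisjointFamilies.card_pbond P 0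
  have hTr : Tr.card = T - 1 := card_combTree P 0
  have hplaq : Fintype.card (Plaq P 0) ≤ T * (P.d * P.d) := card_plaq_le P 0
  have hd1 : 1 ≤ P.d := P.hd
  have hsplit : c ^ Fintype.card (PBond P 0) = c ^ (Tr.card + 1) * c ^ ((P.d - 1) * T) := by
    rw [← pow_add]; congr 1
    rw [hbonds, hTr, Nat.sub_add_cancel hT1]
    have hd' : P.d = (P.d - 1) + 1 := (Nat.sub_add_cancel hd1).symm
    conv_lhs => rw [hd']
    ring
  have hZge : κ * c ^ ((P.d - 1) * T) ≤ partitionFn (G := G) P β := by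
    have h1 : c ^ (Tr.card + 1) * (κ * c ^ ((P.d - 1) * T)) ≤ c ^ (Tr.card + 1) * partitionFn (G := G) P β := by
      calc c ^ (Tr.card + 1) * (κ * c ^ ((P.d - 1) * T)) = κ * c ^ Fintype.card (PBond P 0) := by rw [hsplit]; ring
        _ ≤ c * (c ^ Tr.card * partitionFn (G := G) P β) := hmain
        _ = c ^ (Tr.card + 1) * partitionFn (G := G) P β := by ring
    exact le_of_mul_le_mul_left h1 (pow_pos hcpos _)
  have hlogZ := Real.log_le_log (mul_pos (Real.exp_pos _) (pow_pos hcpos _)) hZge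
  rw [Real.log_mul (Real.exp_pos _).ne' (pow_pos hcpos _).ne', Real.log_exp, Real.log_pow] at hlogZ
  refine le_trans ?_ hlogZ
  have hexp : -(β * (8 * τ ^ 2 * Fintype.card (Plaq P 0))) = -(8 * (Fintype.card (Plaq P 0) : ℝ)) := by rw [hτsq]; field_simp
  have hplaqR : (Fintype.card (Plaq P 0) : ℝ) ≤ (T : ℝ) * ((P.d : ℝ) * (P.d : ℝ)) := by exact_mod_cast hplaq
  have hlogc := log_haarReal_suOpBall_ge N hτ hτ1
  rw [hlogτ] at hlogc
  have hfree : (((P.d - 1) * T : ℕ) : ℝ) = ((P.d : ℝ) - 1) * (T : ℝ) := by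
    rw [Nat.cast_mul, Nat.cast_sub hd1]; norm_num
  have hfree_nonneg : 0 ≤ ((P.d : ℝ) - 1) * (T : ℝ) := by rw [← hfree]; exact Nat.cast_nonneg _
  rw [hexp, hfree]
  have hkey : ((P.d : ℝ) - 1) * (T : ℝ) *
      ((((N * N : ℕ) : ℝ) - 1) * (-(1 / 2) * Real.log β) - (((N * N : ℕ) : ℝ) * Real.log (16 * Real.pi + 1) + Real.log ((2 * N + 1) / (4 * Real.pi)))) ≤
      ((P.d : ℝ) - 1) * (T : ℝ) * Real.log c := mul_le_mul_of_nonneg_left hlogc hfree_nonneg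
  nlinarith [hkey, hplaqR]

end LowerBound

end Summit.QuantumFields.YangMills.Theorems.CoarseStiffnessTailAbelianFlatLowerBound

end
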